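import Mathlib.MeasureTheory.Function.ConvergenceInMeasure
import Mathlib.MeasureTheory.Function.LpSpace.Indicator
import Mathlib.MeasureTheory.Integral.DominatedConvergence
import Mathlib.Topology.Baire.CompleteMetrizable
import Mathlib.Topology.Baire.Lemmas
import HarnessLib

/-!
# The Vitali–Hahn–Saks theorem for sequences of `L¹` densities

Topic: Analysis / FunctionSpaces (the measure theory behind the necessity half of the
Dunford–Pettis theorem, `Literature.Analysis.FunctionSpaces.WeakCompactnessL1`).

* `Literature.Analysis.FunctionSpaces.vitaliHahnSaks_setIntegral` (**proved**; Fonseca–Leoni 2007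
  Thm 2.53, in the density form in which it is applied in Step 1 of the proof of Thm 2.54): let
  `μ ≪ μ'` be two measures, `f n ∈ L¹(μ)` a sequence such that each indefinite integral
  `s ↦ ∫_s ‖f n‖ dμ` is absolutely continuous with respect to `μ'` (`ε`–`δ`), and such that
  `(∫ f n · φ dμ)_n` is a Cauchy sequence for every `μ`-a.e. strongly measurable `φ` with values
  in `[0, 1]`. Then the signed measures `ν_n = f n • μ` are **uniformly** absolutely continuous
  with respect to `μ'`: for every `ε > 0` there is `δ > 0` with `|∫_s f n dμ| ≤ ε` for *all* `n`
  and all measurable `s` with `μ' s < δ`.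
* `Literature.Analysis.FunctionSpaces.eLpNorm_indicator_le_of_forall_abs_setIntegral_le`
  (**proved**, folklore): if `|∫_t f dμ| ≤ ε` for every measurable `t ⊆ s`, then
  `‖1_s f‖_{L¹(μ)} ≤ 2ε` (split `s` along the sign of `f`; Fonseca–Leoni 2007, proof of Thm 2.54,
  end of Substep 1b).

Proof of the first result: Fonseca–Leoni's Baire-category proof of Thm 2.53, run on the whole
Banach space `L¹(μ')` rather than on its closed subset of indicator functions. With the
truncation `c t = max (min t 1) 0`, the functionals `Φ_n u = ∫ f n · (c ∘ u) dμ` are continuous on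
`L¹(μ')` (an `L¹(μ')`-convergent sequence has a `μ'`-a.e., hence `μ`-a.e., convergent
subsequence, and dominated convergence applies); the closed sets
`F_N = {u | ∀ n ≥ N, |Φ_n u - Φ_N u| ≤ ε/3}` cover `L¹(μ')` by the Cauchy hypothesis, so by the
Baire category theorem one `F_N` contains a ball `B(u₀, r)`; when `μ' s` is small the two
functions `u₀ 1_{sᶜ}` and `u₀ 1_{sᶜ} + 1_s` lie in that ball and the difference of their `Φ_n`
values is exactly `∫_s f n dμ`, whence `|∫_s f n dμ - ∫_s f N dμ| ≤ 2ε/3` for `n ≥ N`; the finitely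
many indices `n ≤ N` are covered by the individual absolute continuity.

## Mathlib

Mathlib (this pin) has the Baire category theorem (`BaireSpace.of_completelyPseudoMetrizable`,
`nonempty_interior_of_iUnion_of_closed`), complete `Lp` spaces (`MeasureTheory.Lp.instCompleteSpace`)
and "`Lp` convergence ⇒ convergence in measure ⇒ a.e. convergence of a subsequence"
(`MeasureTheory.tendstoInMeasure_of_tendsto_Lp`, `TendstoInMeasure.exists_seq_tendsto_ae`), but no
Vitali–Hahn–Saks or Nikodým convergence theorem (searched `Vitali`, `Hahn`, `Nikodym`,
`uniformly absolutely continuous` under `Mathlib/MeasureTheory`: only Vitali covering/convergence,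
Hahn decomposition and Radon–Nikodym).

## References

* I. Fonseca, G. Leoni, *Modern Methods in the Calculus of Variations: `L^p` Spaces*, Springer
  (2007), Thm 2.53 (Vitali–Hahn–Saks) and the proof of Thm 2.54 (Dunford–Pettis), Step 1.
* N. Dunford, J. T. Schwartz, *Linear Operators I* (1958), III.7.2 (Vitali–Hahn–Saks).
-/

noncomputable section

open MeasureTheory Filter Set Topology
open scoped ENNReal NNReal

namespace Literature.Analysis.FunctionSpaces

variable {α : Type*} [MeasurableSpace α] {μ : Measure α}

/-- **Sign splitting.** If `f` is integrable and `|∫_t f dμ| ≤ ε` for every measurable `t ⊆ s`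
(`s` measurable), then `‖1_s f‖_{L¹(μ)} ≤ 2 ε`: write `∫_s |f| = ∫_{s ∩ {f ≥ 0}} f - ∫_{s ∩ {f < 0}} f`
(with a strongly measurable representative of `f` to make the two pieces measurable). This is how
uniform bounds on the signed measures `s ↦ ∫_s f_n` are turned into equi-integrability
(Fonseca–Leoni 2007, proof of Thm 2.54, Substep 1b). [folklore] -/
theorem eLpNorm_indicator_le_of_forall_abs_setIntegral_le {f : α → ℝ} (hf : Integrable f μ)
    {s : Set α} (hs : MeasurableSet s) {ε : ℝ}
    (h : ∀ t, MeasurableSet t → t ⊆ s → |∫ x in t, f x ∂μ| ≤ ε) :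
    eLpNorm (s.indicator f) 1 μ ≤ ENNReal.ofReal (2 * ε) := by
  set g : α → ℝ := hf.1.mk f with hg_def
  have hg_meas : StronglyMeasurable g := hf.1.stronglyMeasurable_mk
  have hfg : f =ᵐ[μ] g := hf.1.ae_eq_mk
  have hP : MeasurableSet {x | 0 ≤ g x} := measurableSet_le measurable_const hg_meas.measurable
  rw [eLpNorm_indicator_eq_eLpNorm_restrict hs, eLpNorm_one_eq_lintegral_enorm,
    ← ofReal_integral_norm_eq_lintegral_enorm hf.integrableOn]
  refine ENNReal.ofReal_le_ofReal ?_
  rw [← integral_inter_add_sdiff hP hf.norm.integrableOn]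
  have h1 : ∫ x in s ∩ {x | 0 ≤ g x}, ‖f x‖ ∂μ = ∫ x in s ∩ {x | 0 ≤ g x}, f x ∂μ := by
    refine setIntegral_congr_ae (hs.inter hP) ?_
    filter_upwards [hfg] with x hx hxs
    rw [Real.norm_eq_abs, abs_of_nonneg]
    rw [hx]; exact hxs.2
  have h2 : ∫ x in s \ {x | 0 ≤ g x}, ‖f x‖ ∂μ = -∫ x in s \ {x | 0 ≤ g x}, f x ∂μ := by
    rw [← integral_neg]
    refine setIntegral_congr_ae (hs.diff hP) ?_
    filter_upwards [hfg] with x hx hxs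
    rw [Real.norm_eq_abs, abs_of_neg]
    have : ¬ 0 ≤ g x := hxs.2
    rw [hx]; exact not_le.1 this
  rw [h1, h2]
  calc ∫ x in s ∩ {x | 0 ≤ g x}, f x ∂μ + -∫ x in s \ {x | 0 ≤ g x}, f x ∂μ
      ≤ |∫ x in s ∩ {x | 0 ≤ g x}, f x ∂μ| + |∫ x in s \ {x | 0 ≤ g x}, f x ∂μ| :=
        add_le_add (le_abs_self _) (neg_le_abs _)
    _ ≤ ε + ε := add_le_add (h _ (hs.inter hP) inter_subset_left) (h _ (hs.diff hP) sdiff_subset)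
    _ = 2 * ε := by ring

/-- **Vitali–Hahn–Saks theorem**, density form (Fonseca–Leoni 2007, Thm 2.53, as applied in Step 1
of the proof of Thm 2.54). Let `μ ≪ μ'` be measures on `α`, let `f n` (`n ∈ ℕ`) be `μ`-integrable
with each `s ↦ ∫_s ‖f n‖ dμ` absolutely continuous with respect to `μ'` in the quantitative sense
`μ' s < δ ⇒ ∫⁻_s ‖f n‖ₑ dμ < ε`, and assume that `(∫ f n · φ dμ)_n` is a Cauchy sequence for every
`μ`-a.e. strongly measurable `φ : α → ℝ` with `0 ≤ φ ≤ 1` (for `φ = 1_E` this says that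
`lim_n ν_n(E)` exists for the signed measures `ν_n = f n • μ`). Then the `ν_n` are *uniformly*
absolutely continuous with respect to `μ'`: for every `ε > 0` there is `δ > 0` such that
`|∫_s f n dμ| ≤ ε` for all `n` and all measurable `s` with `μ' s < δ`.

Fonseca–Leoni state Thm 2.53 for finite signed measures `λ_n ≪ μ` such that `lim_n λ_n(E)` exists
for every `E` of finite `μ`-measure; the present statement is the case `λ_n = f n • μ` with the
auxiliary measure (`μ` itself in Substep 1b, the finite measure `ν = v • μ` in Substep 1c of the
proof of Thm 2.54) as the parameter `μ'`, under the (stronger) Cauchy hypothesis for all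
`[0, 1]`-valued multipliers, which is what weak convergence in `L¹` provides. Proof by the Baire
category theorem in `L¹(μ')`, see the module docstring. [cite: FonsecaLeoni2007, Thm 2.53] -/
theorem vitaliHahnSaks_setIntegral {μ μ' : Measure α} (hμμ' : μ ≪ μ') {f : ℕ → α → ℝ}
    (hf : ∀ n, Integrable (f n) μ)
    (hac : ∀ n, ∀ ε : ℝ≥0∞, ε ≠ 0 → ∃ δ : ℝ≥0∞, 0 < δ ∧ ∀ s, MeasurableSet s → μ' s < δ →
      ∫⁻ x in s, ‖f n x‖ₑ ∂μ < ε)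
    (hC : ∀ φ : α → ℝ, AEStronglyMeasurable φ μ → (∀ x, 0 ≤ φ x) → (∀ x, φ x ≤ 1) →
      CauchySeq fun n => ∫ x, f n x * φ x ∂μ)
    {ε : ℝ} (hε : 0 < ε) :
    ∃ δ : ℝ≥0∞, 0 < δ ∧ ∀ s, MeasurableSet s → μ' s < δ → ∀ n, |∫ x in s, f n x ∂μ| ≤ ε := by
  -- the truncation `c t = max (min t 1) 0` and the functionals `Φ n u = ∫ f n · (c ∘ u) dμ`
  -- on `L¹(μ')`
  set c : ℝ → ℝ := fun t => max (min t 1) 0 with hc_def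
  have hc0 : ∀ t, 0 ≤ c t := fun t => le_max_right _ _
  have hc1 : ∀ t, c t ≤ 1 := fun t => max_le (min_le_right _ _) zero_le_one
  have hc_norm : ∀ t, ‖c t‖ ≤ 1 := fun t => by
    rw [Real.norm_eq_abs, abs_of_nonneg (hc0 t)]; exact hc1 t
  have hc_cont : Continuous c := (continuous_id.min continuous_const).max continuous_const
  have hc_zero : c 0 = 0 := by simp [hc_def]
  have hc_one : c 1 = 1 := by simp [hc_def]
  set Φ : ℕ → Lp ℝ 1 μ' → ℝ := fun n u => ∫ x, f n x * c (u x) ∂μ with hΦ_def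
  have hmeas : ∀ u : Lp ℝ 1 μ', AEStronglyMeasurable (fun x => c (u x)) μ := fun u =>
    hc_cont.comp_aestronglyMeasurable ((Lp.aestronglyMeasurable u).mono_ac hμμ')
  have hint : ∀ n (u : Lp ℝ 1 μ'), Integrable (fun x => f n x * c (u x)) μ := fun n u =>
    (hf n).mul_bdd (hmeas u) (Eventually.of_forall fun x => hc_norm _)
  -- Step 1: each `Φ n` is continuous on `L¹(μ')` (dominated convergence along a.e.-convergent
  -- subsequences).
  have hΦ_cont : ∀ n, Continuous (Φ n) := by
    intro n
    refine continuous_iff_continuousAt.2 fun u => ?_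
    refine tendsto_of_subseq_tendsto fun v hv => ?_
    have h1 : TendstoInMeasure μ' (fun k => ((v k : Lp ℝ 1 μ') : α → ℝ)) atTop
        ((u : Lp ℝ 1 μ') : α → ℝ) := tendstoInMeasure_of_tendsto_Lp hv
    obtain ⟨ms, -, hms⟩ := h1.exists_seq_tendsto_ae
    refine ⟨ms, ?_⟩
    change Tendsto (fun k => ∫ x, f n x * c (v (ms k) x) ∂μ) atTop
      (𝓝 (∫ x, f n x * c (u x) ∂μ))
    refine tendsto_integral_of_dominated_convergence (fun x => ‖f n x‖)
      (fun k => (hint n (v (ms k))).aestronglyMeasurable) (hf n).norm ?_ ?_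
    · intro k
      filter_upwards with x
      rw [norm_mul]
      calc ‖f n x‖ * ‖c (v (ms k) x)‖ ≤ ‖f n x‖ * 1 := by gcongr; exact hc_norm _
        _ = ‖f n x‖ := mul_one _
    · filter_upwards [hμμ'.ae_le hms] with x hx
      exact tendsto_const_nhds.mul ((hc_cont.tendsto _).comp hx)
  -- Step 2: the closed sets `F N`
  set F : ℕ → Set (Lp ℝ 1 μ') := fun N => ⋂ n, ⋂ (_ : N ≤ n), {u | |Φ n u - Φ N u| ≤ ε / 3}
    with hF_def
  have hF_closed : ∀ N, IsClosed (F N) := fun N =>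
    isClosed_iInter fun n => isClosed_iInter fun _ =>
      isClosed_le ((hΦ_cont n).sub (hΦ_cont N)).abs continuous_const
  have hF_mem : ∀ N u, u ∈ F N ↔ ∀ n, N ≤ n → |Φ n u - Φ N u| ≤ ε / 3 := fun N u => by
    simp only [hF_def, mem_iInter, mem_setOf_eq]
  -- Step 3: they cover (Cauchy property of `Φ n u`)
  have hcover : ⋃ N, F N = univ := by
    refine eq_univ_of_forall fun u => ?_
    have hcs := hC _ (hmeas u) (fun x => hc0 _) (fun x => hc1 _)
    obtain ⟨N, hN⟩ := Metric.cauchySeq_iff'.1 hcs (ε / 3) (by positivity)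
    refine mem_iUnion.2 ⟨N, (hF_mem N u).2 fun n hn => ?_⟩
    have := hN n hn
    rw [Real.dist_eq] at this
    exact this.le
  -- Step 4: Baire
  obtain ⟨N, u₀, hu₀⟩ := nonempty_interior_of_iUnion_of_closed hF_closed hcover
  obtain ⟨r, hr, hball⟩ := Metric.isOpen_iff.1 isOpen_interior u₀ hu₀
  have hballF : Metric.ball u₀ r ⊆ F N := hball.trans interior_subset
  -- Step 5: choice of `δ`
  have hu₀_int : ∫⁻ x, ‖u₀ x‖ₑ ∂μ' ≠ ∞ := by
    have := (Lp.memLp u₀).eLpNorm_lt_top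
    rw [eLpNorm_one_eq_lintegral_enorm] at this
    exact this.ne
  have hr3 : 0 < r / 3 := by positivity
  obtain ⟨δ₀, hδ₀, hδ₀'⟩ := exists_pos_setLIntegral_lt_of_measure_lt hu₀_int
    (ENNReal.ofReal_pos.2 hr3).ne'
  have hε3 : ENNReal.ofReal (ε / 3) ≠ 0 := (ENNReal.ofReal_pos.2 (by positivity)).ne'
  choose δf hδf_pos hδf using fun n => hac n (ENNReal.ofReal (ε / 3)) hε3
  have hne : (Finset.range (N + 1)).Nonempty := ⟨0, Finset.mem_range.2 (Nat.succ_pos N)⟩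
  set δ : ℝ≥0∞ := min (min δ₀ (ENNReal.ofReal (r / 3))) ((Finset.range (N + 1)).inf' hne δf)
    with hδ_def
  have hδ_pos : 0 < δ := by
    refine lt_min (lt_min hδ₀ (ENNReal.ofReal_pos.2 hr3)) ?_
    exact (Finset.lt_inf'_iff _).2 fun n _ => hδf_pos n
  refine ⟨δ, hδ_pos, fun s hs hsδ n => ?_⟩
  have hsδ₀ : μ' s < δ₀ := lt_of_lt_of_le hsδ ((min_le_left _ _).trans (min_le_left _ _))
  have hsr : μ' s < ENNReal.ofReal (r / 3) :=
    lt_of_lt_of_le hsδ ((min_le_left _ _).trans (min_le_right _ _))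
  have hsf : ∀ m, m ≤ N → μ' s < δf m := fun m hm =>
    lt_of_lt_of_le hsδ ((min_le_right _ _).trans
      (Finset.inf'_le _ (Finset.mem_range.2 (Nat.lt_succ_of_le hm))))
  have hs_top : μ' s ≠ ∞ := (hsr.trans ENNReal.ofReal_lt_top).ne
  -- `|∫_s f m| ≤ ε/3` for `m ≤ N`
  have hsmall : ∀ m, m ≤ N → |∫ x in s, f m x ∂μ| ≤ ε / 3 := by
    intro m hm
    have h1 := hδf m s hs (hsf m hm)
    calc |∫ x in s, f m x ∂μ| ≤ ∫ x in s, |f m x| ∂μ := abs_integral_le_integral_abs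
      _ = (∫⁻ x in s, ‖f m x‖ₑ ∂μ).toReal := by
          rw [← ofReal_integral_norm_eq_lintegral_enorm (hf m).integrableOn,
            ENNReal.toReal_ofReal (integral_nonneg fun x => norm_nonneg _)]
          simp only [Real.norm_eq_abs]
      _ ≤ (ENNReal.ofReal (ε / 3)).toReal := ENNReal.toReal_mono ENNReal.ofReal_ne_top h1.le
      _ = ε / 3 := ENNReal.toReal_ofReal (by positivity)
  -- Step 6: the two perturbations of `u₀`
  set u₂ : Lp ℝ 1 μ' := ((Lp.memLp u₀).indicator hs.compl).toLp _ with hu₂_def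
  set u₁ : Lp ℝ 1 μ' := u₂ + indicatorConstLp 1 hs hs_top (1 : ℝ) with hu₁_def
  have hu₂_ae : (u₂ : α → ℝ) =ᵐ[μ'] sᶜ.indicator (u₀ : α → ℝ) := MemLp.coeFn_toLp _
  have hu₁_ae : (u₁ : α → ℝ) =ᵐ[μ']
      fun x => sᶜ.indicator (u₀ : α → ℝ) x + s.indicator (fun _ => (1 : ℝ)) x := by
    filter_upwards [Lp.coeFn_add u₂ (indicatorConstLp 1 hs hs_top (1 : ℝ)), hu₂_ae,
      (indicatorConstLp_coeFn : ⇑(indicatorConstLp 1 hs hs_top (1 : ℝ)) =ᵐ[μ'] _)]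
      with x hx h2 h3
    rw [hx, Pi.add_apply, h2, h3]
  have hd₂ : dist u₂ u₀ ≤ r / 3 := by
    rw [Lp.dist_def]
    have : ((u₂ : α → ℝ) - (u₀ : α → ℝ)) =ᵐ[μ'] -(s.indicator (u₀ : α → ℝ)) := by
      filter_upwards [hu₂_ae] with x hx
      simp only [Pi.sub_apply, Pi.neg_apply, hx]
      by_cases hxs : x ∈ s
      · simp [hxs]
      · simp [hxs]
    rw [eLpNorm_congr_ae this, eLpNorm_neg, eLpNorm_indicator_eq_eLpNorm_restrict hs,
      eLpNorm_one_eq_lintegral_enorm]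
    calc (∫⁻ x in s, ‖(u₀ : α → ℝ) x‖ₑ ∂μ').toReal ≤ (ENNReal.ofReal (r / 3)).toReal :=
          ENNReal.toReal_mono ENNReal.ofReal_ne_top (hδ₀' s hsδ₀).le
      _ = r / 3 := ENNReal.toReal_ofReal hr3.le
  have hind_norm : ‖indicatorConstLp 1 hs hs_top (1 : ℝ)‖ < r / 3 := by
    rw [norm_indicatorConstLp one_ne_zero ENNReal.one_ne_top]
    simp only [norm_one, ENNReal.toReal_one, _root_.div_one, Real.rpow_one, one_mul]
    exact ENNReal.toReal_lt_of_lt_ofReal hsr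
  have hd₁ : dist u₁ u₀ < r := by
    calc dist u₁ u₀ ≤ dist u₁ u₂ + dist u₂ u₀ := dist_triangle _ _ _
      _ = ‖indicatorConstLp 1 hs hs_top (1 : ℝ)‖ + dist u₂ u₀ := by
          rw [hu₁_def, dist_eq_norm, add_sub_cancel_left]
      _ < r / 3 + r / 3 := add_lt_add_of_lt_of_le hind_norm hd₂
      _ < r := by linarith
  have hu₁F : u₁ ∈ F N := hballF (Metric.mem_ball.2 hd₁)
  have hu₂F : u₂ ∈ F N := hballF (Metric.mem_ball.2 (hd₂.trans_lt (by linarith)))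
  -- the key identity `Φ m u₁ - Φ m u₂ = ∫_s f m dμ`
  have hkey : ∀ m, Φ m u₁ - Φ m u₂ = ∫ x in s, f m x ∂μ := by
    intro m
    simp only [hΦ_def]
    rw [← integral_sub (hint m u₁) (hint m u₂), ← integral_indicator hs]
    refine integral_congr_ae ?_
    filter_upwards [hμμ'.ae_le hu₁_ae, hμμ'.ae_le hu₂_ae] with x h1 h2
    rw [h1, h2]
    by_cases hx : x ∈ s
    · have hx' : x ∉ sᶜ := fun h => h hx
      simp [hx, hx', hc_zero, hc_one]
    · have hx' : x ∈ sᶜ := hx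
      simp [hx, hx']
  by_cases hn : N ≤ n
  · have h1 : |Φ n u₁ - Φ N u₁| ≤ ε / 3 := (hF_mem N u₁).1 hu₁F n hn
    have h2 : |Φ n u₂ - Φ N u₂| ≤ ε / 3 := (hF_mem N u₂).1 hu₂F n hn
    have h3 : |∫ x in s, f N x ∂μ| ≤ ε / 3 := hsmall N le_rfl
    have e1 := hkey n
    have e2 := hkey N
    have : ∫ x in s, f n x ∂μ =
        (Φ n u₁ - Φ N u₁) - (Φ n u₂ - Φ N u₂) + ∫ x in s, f N x ∂μ := by linarith
    rw [this]
    calc |(Φ n u₁ - Φ N u₁) - (Φ n u₂ - Φ N u₂) + ∫ x in s, f N x ∂μ|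
        ≤ |Φ n u₁ - Φ N u₁| + |Φ n u₂ - Φ N u₂| + |∫ x in s, f N x ∂μ| :=
          (abs_add_le _ _).trans (by gcongr; exact abs_sub _ _)
      _ ≤ ε / 3 + ε / 3 + ε / 3 := by gcongr
      _ = ε := by ring
  · exact (hsmall n (not_le.1 hn).le).trans (by linarith)

end Literature.Analysis.FunctionSpaces
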